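import Mathlib
import Summits.Ventures.PercRepro2.Defs
import Summits.Ventures.PercRepro2.Graph
import Summits.Ventures.PercRepro2.HullDefs
import Summits.Ventures.PercRepro2.LocRows
import Summits.Ventures.PercRepro2.SwRow
import Summits.Ventures.PercRepro2.SwAllRow

/-!
# Row (GADl⁻): the rigid-at-`l` injection keeping every red edge outside `C_R(l)` (blind cell
PercRepro2, night-4 g8, 2026-08-25; proofs/NIGHT4-G8.md §3)

Free fibre, marks `l, h, o`; `Q = {h ∉ H_l, o ∈ R_side(l)}` (= `tgtU` at the principal up-set),
`σQ = {h ∉ H_l, o ∈ B_side(l)}` (= `srcU`).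

* **`RigidL`** (rung R1 of NIGHT4-G8.md §3): an injection `Q → σQ` under which every red edge of the
  source NOT inside `C_R(l)` stays red — the image may only turn red edges INSIDE l's red cluster
  blue (census: 0 / 460 at n = 5, 0 / 4,626 at n = 6 m ≤ 9);
* `mem_awayL_of_within_cluster`: the red edges inside `C_R(h)` of a source lie outside `C_R(l)`
  (the two red clusters are disjoint when `h ∉ C_R(l)`), so the composition with the colour swap
  is a rigid permutation of `Q`: **`swAll_of_rigidL : RigidL → SwAll`** — (GADl⁻) ⟹ 2′SW-ALL ⟹ (SW);
  `sw_all_of_rigidL_all`.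
-/

namespace Summit.Ventures.PercRepro2

namespace LocRows

open Hull

variable {V : Type*} {E : Type*} [Fintype E] [DecidableEq E]

open scoped Classical

variable (ends : E → Sym2 V)

/-- The red edges of `ζ` away from the red cluster of `l`. -/
def awayL (l : V) (ζ : Config E) : Set E :=
  {e | ζ e = true ∧ e ∉ within ends (cluster ends ζ l)}

/-- **Row (GADl⁻)**: an injection of `Q = {h ∉ H_l, o ∈ R_side}` into `σQ = {h ∉ H_l, o ∈ B_side}`
under which every red edge outside `C_R(l)` of the source is red in the image. -/
def RigidL (l h o : V) : Prop :=
  ∃ f : {ζ // ζ ∈ tgtU ends l h {S : Set V | o ∈ S}} → Config E, Function.Injective f ∧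
    ∀ x, f x ∈ srcU ends l h {S : Set V | o ∈ S} ∧ ∀ e, e ∈ awayL ends l x.1 → f x e = true

variable {ends}

omit [Fintype E] [DecidableEq E] in
/-- A red edge inside `C_R(h)` is away from `C_R(l)` when `h ∉ C_R(l)`. -/
lemma mem_awayL_of_within_cluster {l h : V} {ζ : Config E} (hh : h ∉ cluster ends ζ l) {e : E}
    (he : e ∈ within ends (cluster ends ζ h)) (hred : ζ e = true) : e ∈ awayL ends l ζ := by
  refine ⟨hred, ?_⟩
  rintro ⟨x, hx, y, _, hxy⟩
  obtain ⟨x', hx', y', hy', hxy'⟩ := he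
  rw [hxy, Sym2.eq_iff] at hxy'
  have hxh : x ∈ cluster ends ζ h := by
    rcases hxy' with ⟨rfl, _⟩ | ⟨rfl, _⟩
    · exact hx'
    · exact hy'
  apply hh
  simp only [mem_cluster] at hx hxh ⊢
  exact conn_trans hx (conn_symm hxh)

/-- A member of `Q` has `h ∉ C_R(l)`. -/
lemma not_mem_cluster_of_mem_tgtU {l h o : V} {ζ : Config E}
    (hζ : ζ ∈ tgtU ends l h {S : Set V | o ∈ S}) : h ∉ cluster ends ζ l := by
  simp only [tgtU, Finset.mem_filter, Finset.mem_univ, true_and, hull, Set.mem_union,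
    not_or] at hζ
  exact hζ.1.1

/-- **(GADl⁻) gives 2′SW-ALL**: compose the injection with the colour swap. -/
theorem swAll_of_rigidL {l h o : V} (hr : RigidL ends l h o) : SwAll ends l h o := by
  obtain ⟨f, hf, hmem⟩ := hr
  refine ⟨fun x => blue (f x), ?_, fun x => ⟨?_, ?_⟩⟩
  · intro x y hxy
    apply hf
    have := congrArg blue hxy
    simpa only [blue_blue] using this
  · exact (blue_mem_tgtU_iff ends).2 (hmem x).1
  · intro e he hred
    show blue (f x) e = false
    rw [blue_apply, Bool.not_eq_false']
    exact (hmem x).2 e (mem_awayL_of_within_cluster (not_mem_cluster_of_mem_tgtU x.2) he hred)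

/-- Row (GADl⁻) over all finite graphs and markings. -/
def RigidL_all : Prop :=
  ∀ (V E : Type) [Fintype V] [DecidableEq V] [Fintype E] [DecidableEq E] (ends : E → Sym2 V)
    (l h o : V), l ≠ h → o ≠ l → o ≠ h → RigidL ends l h o

/-- `RigidL_all` gives `SwAll_all`. -/
theorem swAll_all_of_rigidL_all (hr : RigidL_all) : SwAll_all := by
  intro V E _ _ _ _ ends l h o hlh hol hoh
  exact swAll_of_rigidL (hr V E ends l h o hlh hol hoh)

/-- `RigidL_all` gives `Sw_all`. -/
theorem sw_all_of_rigidL_all (hr : RigidL_all) : Sw_all :=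
  sw_all_of_swAll_all (swAll_all_of_rigidL_all hr)

end LocRows

end Summit.Ventures.PercRepro2
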